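import Mathlib
import HarnessLib
import Summits.HubbardSuperconductivity.HubbardSuperconductivity.Theorems.KLProgrammeForwardBubbleSoft
import Summits.HubbardSuperconductivity.HubbardSuperconductivity.Theorems.KLProgrammeMatsubaraSlicePropagatorSharp
import Summits.HubbardSuperconductivity.HubbardSuperconductivity.Theorems.KLProgrammeMatsubaraSliceWeight

/-!
# Route `KLProgramme` — crux K3, ENGINE child (stmt-HubbardSuperconductivity-19855 `KLRegimeEngineV12`): the forward particle–hole slice bubble with a
# SOFT PARTNER — second shell weight WITHOUT inner support radius, at below-resolution transfer (cell gate-hubbard-kl, seat hubbard-kl-k3c2-p2)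

The Wick-ordered step's rung (p1 g8, E2-STRUCTURE-NOTE §4) pairs the slice line `g_n` (weight `w_n`, support `(Λ_n/2)² < s < (4Λ_n)²`) with the SOFT
partner `D_n` (weight `d_n(s) = 1 − χ₂(s/Λ_n²)`: `= 1` near `s = 0`, `= 0` for `s ≥ Λ_n²`).  KEY GEOMETRIC FACT (§2, `klfp_sq_ge`): if the first line is
on the slice (`k₀² + e² > (Λ_n/2)²`) and the transfer is below resolution (`|q₀| ≤ Λ_n/8`, energy shift `|σ| ≤ Λ_n/8`), then the second line is read
only at `s' = (k₀+q₀)² + (e+σ)² ≥ (Λ_n/8)²`.  Hence the second weight may be CUT OFF below `(Λ_n/16)²` without changing the integrand (§1 the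
piecewise-linear cut `klfp_cut`, §3 `klfp_integrand_cut_eq`), after which `…ForwardBubbleSoft` applies with the joint Lipschitz constant of the cut
propagator, `K' = (65ℓ' + 17408M_f'/3)/Λ_n²` (`klsq_propagator_lipschitz` with `r₁ = Λ_n/16`, `r₂ = 4Λ_n`; §1).  Results: the generic soft-partner
planar bound `klfp_planar_bubble_norm_le_soft` (§4) and the CARRIER instance `(w_n, d_n)` with absolute constants (§5, `klfp_planar_softBubble_norm_le`):
`‖β⁻¹•Σ_i ∫d²p A(p)Φ_{w_n}(ω_i,e(p))Φ_{d_n}(ω_i+q₀,e'(p))‖ ≤ 2^25·L_W·Λ_n + 2^25·B_W·(π/β)/Λ_n + 2^22·B_W·(|q₀| + δ_max)/Λ_n`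
(`|q₀|, δ_max ≤ Λ_n/8`).  Pure analysis; nothing about the model's effective action is asserted.
-/

noncomputable section

namespace Summit.HubbardSuperconductivity.HubbardSuperconductivity.Theorems.KLRegimeSplit

set_option linter.dupNamespace false -- summit = problem name (single-conjunct summit), D-0017

open Real Set Filter MeasureTheory intervalIntegral Complex Literature.MathematicalPhysics.QuantumLattice
open Literature.MathematicalPhysics.QuantumLattice.BandSectorCounting Literature.Probability.LatticeModels
open Summit.HubbardSuperconductivity.HubbardSuperconductivity.Theorems.PerturbedFermiCurve
open Summit.HubbardSuperconductivity.HubbardSuperconductivity.Theorems.KLProgrammeLegKernels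

/-! ## §1 The cut below `(Λ/16)²` and the cut weight -/

/-- **The piecewise-linear cut** `η_Λ(s) = min 1 (max 0 ((s − (Λ/16)²)·256/(3Λ²)))`: `0` for `s ≤ (Λ/16)²`, `1` for `s ≥ (Λ/8)²`. -/
def klfp_cut (Λ s : ℝ) : ℝ := min 1 (max 0 ((s - (Λ / 16) ^ 2) * (256 / (3 * Λ ^ 2))))

/-- `0 ≤ η ≤ 1`. -/
theorem klfp_cut_mem (Λ s : ℝ) : klfp_cut Λ s ∈ Icc (0 : ℝ) 1 :=
  ⟨le_min zero_le_one (le_max_left _ _), min_le_left _ _⟩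

/-- `η(s) = 1` for `s ≥ (Λ/8)²` (`Λ ≠ 0`). -/
theorem klfp_cut_eq_one {Λ : ℝ} (hΛ : Λ ≠ 0) {s : ℝ} (hs : (Λ / 8) ^ 2 ≤ s) : klfp_cut Λ s = 1 := by
  unfold klfp_cut
  have hΛ2 : 0 < Λ ^ 2 := by positivity
  have h1 : 1 ≤ (s - (Λ / 16) ^ 2) * (256 / (3 * Λ ^ 2)) := by
    have hs' : 0 ≤ s - (Λ / 8) ^ 2 := sub_nonneg.mpr hs
    have : (s - (Λ / 16) ^ 2) * (256 / (3 * Λ ^ 2)) - 1 = (s - (Λ / 8) ^ 2) * (256 / (3 * Λ ^ 2)) := by field_simp; ring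
    nlinarith [mul_nonneg hs' (le_of_lt (by positivity : (0:ℝ) < 256 / (3 * Λ ^ 2)))]
  rw [min_eq_left (le_max_of_le_right h1)]

/-- `η(s) = 0` for `s ≤ (Λ/16)²`. -/
theorem klfp_cut_eq_zero {Λ s : ℝ} (hs : s ≤ (Λ / 16) ^ 2) : klfp_cut Λ s = 0 := by
  unfold klfp_cut
  have h : (s - (Λ / 16) ^ 2) * (256 / (3 * Λ ^ 2)) ≤ 0 :=
    mul_nonpos_of_nonpos_of_nonneg (by linarith) (by positivity)
  rw [max_eq_left h, min_eq_right zero_le_one]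

/-- `η` is `256/(3Λ²)`-Lipschitz. -/
theorem klfp_cut_lipschitz (Λ s s' : ℝ) : |klfp_cut Λ s - klfp_cut Λ s'| ≤ 256 / (3 * Λ ^ 2) * |s - s'| := by
  unfold klfp_cut
  have h1 := abs_min_sub_min_le_max (1 : ℝ) ((max 0 ((s - (Λ / 16) ^ 2) * (256 / (3 * Λ ^ 2)))))
    1 (max 0 ((s' - (Λ / 16) ^ 2) * (256 / (3 * Λ ^ 2))))
  have h2 := abs_max_sub_max_le_max (0 : ℝ) ((s - (Λ / 16) ^ 2) * (256 / (3 * Λ ^ 2))) 0 ((s' - (Λ / 16) ^ 2) * (256 / (3 * Λ ^ 2)))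
  simp only [sub_self, abs_zero] at h1 h2
  have h3 : |(s - (Λ / 16) ^ 2) * (256 / (3 * Λ ^ 2)) - (s' - (Λ / 16) ^ 2) * (256 / (3 * Λ ^ 2))| = 256 / (3 * Λ ^ 2) * |s - s'| := by
    rw [← sub_mul, abs_mul, abs_of_nonneg (by positivity : (0:ℝ) ≤ 256 / (3 * Λ ^ 2))]; ring_nf
  have hnn : (0 : ℝ) ≤ |max 0 ((s - (Λ / 16) ^ 2) * (256 / (3 * Λ ^ 2))) - max 0 ((s' - (Λ / 16) ^ 2) * (256 / (3 * Λ ^ 2)))| :=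
    abs_nonneg _
  calc _ ≤ max 0 |max 0 ((s - (Λ / 16) ^ 2) * (256 / (3 * Λ ^ 2))) - max 0 ((s' - (Λ / 16) ^ 2) * (256 / (3 * Λ ^ 2)))| := h1
    _ = |max 0 ((s - (Λ / 16) ^ 2) * (256 / (3 * Λ ^ 2))) - max 0 ((s' - (Λ / 16) ^ 2) * (256 / (3 * Λ ^ 2)))| := max_eq_right hnn
    _ ≤ max 0 |(s - (Λ / 16) ^ 2) * (256 / (3 * Λ ^ 2)) - (s' - (Λ / 16) ^ 2) * (256 / (3 * Λ ^ 2))| := h2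
    _ = _ := by rw [max_eq_right (abs_nonneg _), h3]

section CutWeight

variable {f' : ℝ → ℂ} {Lf' Mf' : ℝ}

/-- **The cut weight** `f''(s) = f'(s)·η_Λ(s)`: bounded by `M_f'`. -/
theorem klfp_cutWeight_norm_le (hbd' : ∀ s, ‖f' s‖ ≤ Mf') (Λ s : ℝ) : ‖f' s * (klfp_cut Λ s : ℂ)‖ ≤ Mf' := by
  have hη : ‖(klfp_cut Λ s : ℂ)‖ ≤ 1 := by
    rw [Complex.norm_real, Real.norm_of_nonneg (klfp_cut_mem Λ s).1]; exact (klfp_cut_mem Λ s).2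
  exact (klwt_mul_norm_le hbd' (fun s => by
    rw [Complex.norm_real, Real.norm_of_nonneg (klfp_cut_mem Λ s).1]; exact (klfp_cut_mem Λ s).2) s).trans (by rw [mul_one])

/-- The cut weight is `(L_f' + M_f'·256/(3Λ²))`-Lipschitz. -/
theorem klfp_cutWeight_lipschitz (hlip' : ∀ s s', ‖f' s - f' s'‖ ≤ Lf' * |s - s'|) (hbd' : ∀ s, ‖f' s‖ ≤ Mf') (Λ s s' : ℝ) :
    ‖f' s * (klfp_cut Λ s : ℂ) - f' s' * (klfp_cut Λ s' : ℂ)‖ ≤ (Lf' + Mf' * (256 / (3 * Λ ^ 2))) * |s - s'| := by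
  have hηbd : ∀ s, ‖(klfp_cut Λ s : ℂ)‖ ≤ 1 := fun s => by
    rw [Complex.norm_real, Real.norm_of_nonneg (klfp_cut_mem Λ s).1]; exact (klfp_cut_mem Λ s).2
  have hηlip : ∀ s s', ‖(klfp_cut Λ s : ℂ) - (klfp_cut Λ s' : ℂ)‖ ≤ 256 / (3 * Λ ^ 2) * |s - s'| := fun s s' => by
    rw [← Complex.ofReal_sub, Complex.norm_real, Real.norm_eq_abs]; exact klfp_cut_lipschitz Λ s s'
  refine (klwt_mul_lipschitz hbd' hηbd hlip' hηlip s s').trans (le_of_eq ?_)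
  ring

/-- The cut weight vanishes for `s ≤ (Λ/16)²` … -/
theorem klfp_cutWeight_eq_zero_of_le {Λ s : ℝ} (hs : s ≤ (Λ / 16) ^ 2) : f' s * (klfp_cut Λ s : ℂ) = 0 := by
  rw [klfp_cut_eq_zero hs, Complex.ofReal_zero, mul_zero]

/-- … and where `f'` does. -/
theorem klfp_cutWeight_eq_zero_of_ge {r : ℝ} (hout' : ∀ s, r ^ 2 ≤ s → f' s = 0) (Λ : ℝ) {s : ℝ} (hs : r ^ 2 ≤ s) :
    f' s * (klfp_cut Λ s : ℂ) = 0 := by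
  rw [hout' s hs, zero_mul]

/-- The cut weight IS `f'` for `s ≥ (Λ/8)²`. -/
theorem klfp_cutWeight_eq {Λ : ℝ} (hΛ : Λ ≠ 0) {s : ℝ} (hs : (Λ / 8) ^ 2 ≤ s) : f' s * (klfp_cut Λ s : ℂ) = f' s := by
  rw [klfp_cut_eq_one hΛ hs, Complex.ofReal_one, mul_one]

/-- **Joint Lipschitz constant of the cut propagator** at scale `n` (`L_f' ≤ ℓ'/Λ_n²`, `f' = 0` for `s ≥ (4Λ_n)²`):
`K' = (65ℓ' + 17408M_f'/3)/Λ_n²` (`klsq_propagator_lipschitz`, `r₁ = Λ_n/16`, `r₂ = 4Λ_n`). -/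
theorem klfp_prop_cutWeight_lipschitz {ℓ' : ℝ} (hlip' : ∀ s s', ‖f' s - f' s'‖ ≤ Lf' * |s - s'|) (hbd' : ∀ s, ‖f' s‖ ≤ Mf') {n : ℕ}
    (hLf' : Lf' ≤ ℓ' / klScale klE0 n ^ 2) (hout' : ∀ s, (4 * klScale klE0 n) ^ 2 ≤ s → f' s = 0) (k₀ e k₀' e' : ℝ) :
    ‖klfb_prop (fun s => f' s * (klfp_cut (klScale klE0 n) s : ℂ)) k₀ e -
        klfb_prop (fun s => f' s * (klfp_cut (klScale klE0 n) s : ℂ)) k₀' e'‖ ≤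
      (65 * ℓ' + 17408 / 3 * Mf') / klScale klE0 n ^ 2 * (|k₀ - k₀'| + |e - e'|) := by
  set Λ := klScale klE0 n with hΛdef
  have hΛ : 0 < Λ := klth_klScale_pos n
  have hMf' : 0 ≤ Mf' := (norm_nonneg _).trans (hbd' 0)
  have hLf'0 : 0 ≤ Lf' := by
    have := hlip' 0 1; norm_num at this; linarith [norm_nonneg (f' 0 - f' 1)]
  unfold klfb_prop
  rw [klsp_div_propagator_eq (fun s => f' s * (klfp_cut Λ s : ℂ)) k₀ e, klsp_div_propagator_eq (fun s => f' s * (klfp_cut Λ s : ℂ)) k₀' e']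
  have h := klsq_propagator_lipschitz (f := fun s => f' s * (klfp_cut Λ s : ℂ)) (klfp_cutWeight_lipschitz hlip' hbd' Λ)
    (klfp_cutWeight_norm_le hbd' Λ) (fun s hs => klfp_cutWeight_eq_zero_of_le hs) (fun s hs => klfp_cutWeight_eq_zero_of_ge hout' Λ hs)
    (by positivity : 0 < Λ / 16) (by linarith : Λ / 16 ≤ 4 * Λ) k₀ e k₀' e'
  refine h.trans (mul_le_mul_of_nonneg_right ?_ (by positivity))
  have h65 : (1 + 4 * Λ / (Λ / 16)) = 65 := by field_simp; ring
  rw [h65]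
  have hL : 65 * (Lf' + Mf' * (256 / (3 * Λ ^ 2))) ≤ 65 * (ℓ' / Λ ^ 2 + Mf' * (256 / (3 * Λ ^ 2))) := by
    have := add_le_add_right hLf' (Mf' * (256 / (3 * Λ ^ 2))); nlinarith
  calc 65 * (Lf' + Mf' * (256 / (3 * Λ ^ 2))) + Mf' / (Λ / 16) ^ 2
      ≤ 65 * (ℓ' / Λ ^ 2 + Mf' * (256 / (3 * Λ ^ 2))) + Mf' / (Λ / 16) ^ 2 := by linarith
    _ = (65 * ℓ' + 17408 / 3 * Mf') / Λ ^ 2 := by field_simp; ring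

end CutWeight

/-! ## §2 Geometry: a slice line and a below-resolution transfer keep the second line off `s' < (Λ/8)²` -/

/-- **`(Λ/8)² ≤ (k₀+q₀)² + (e+σ)²`** whenever `(Λ/2)² < k₀² + e²`, `|q₀| ≤ Λ/8`, `|σ| ≤ Λ/8` (`Λ ≥ 0`). -/
theorem klfp_sq_ge {Λ k₀ e q₀ σ : ℝ} (hΛ : 0 ≤ Λ) (hs : (Λ / 2) ^ 2 < k₀ ^ 2 + e ^ 2) (hq : |q₀| ≤ Λ / 8) (hσ : |σ| ≤ Λ / 8) :
    (Λ / 8) ^ 2 ≤ (k₀ + q₀) ^ 2 + (e + σ) ^ 2 := by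
  have hq' := abs_le.mp hq
  have hσ' := abs_le.mp hσ
  rcases le_or_gt (Λ / 4) |e| with he | he
  · -- `|e| ≥ Λ/4`: then `|e + σ| ≥ Λ/8`
    have h1 : Λ / 8 ≤ |e + σ| := by
      have := abs_sub_abs_le_abs_sub e (-σ)
      rw [abs_neg, sub_neg_eq_add] at this
      linarith
    have h2 : (Λ / 8) ^ 2 ≤ (e + σ) ^ 2 := by
      rw [← sq_abs (e + σ)]; exact pow_le_pow_left₀ (by positivity) h1 2
    nlinarith [sq_nonneg (k₀ + q₀)]
  · -- `|e| < Λ/4`: then `k₀² > 3Λ²/16`, so `|k₀| > Λ/8 + Λ/4` and `|k₀ + q₀| ≥ |k₀| − Λ/8`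
    have he2 : e ^ 2 < (Λ / 4) ^ 2 := by
      rw [← sq_abs e]; exact pow_lt_pow_left₀ he (abs_nonneg e) two_ne_zero
    have hk2 : 3 * Λ ^ 2 / 16 < k₀ ^ 2 := by nlinarith
    have hk : 3 * Λ / 8 ≤ |k₀| := by
      by_contra hlt
      push Not at hlt
      have : k₀ ^ 2 < (3 * Λ / 8) ^ 2 := by rw [← sq_abs k₀]; exact pow_lt_pow_left₀ hlt (abs_nonneg _) two_ne_zero
      nlinarith
    have h1 : Λ / 4 ≤ |k₀ + q₀| := by
      have := abs_sub_abs_le_abs_sub k₀ (-q₀)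
      rw [abs_neg, sub_neg_eq_add] at this
      linarith
    have h2 : (Λ / 4) ^ 2 ≤ (k₀ + q₀) ^ 2 := by
      rw [← sq_abs (k₀ + q₀)]; exact pow_le_pow_left₀ (by positivity) h1 2
    nlinarith [sq_nonneg (e + σ)]

/-! ## §3 The integrand with the cut second weight equals the integrand (below-resolution transfer) -/

section CutIntegrand

variable {δ : (Fin 2 → ℝ) → ℝ} {A : ℝ × ℝ → ℂ} {f f' : ℝ → ℂ} {e' : ℝ × ℝ → ℝ} {μ δmax : ℝ}

/-- **Cutting the second weight below `(Λ_n/16)²` does not change the forward-bubble integrand** when the first weight lives on the slice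
(`f(s) = 0` for `s ≤ (Λ_n/2)²`), `|q₀| ≤ Λ_n/8`, and `|e' − e| ≤ δ_max ≤ Λ_n/8` on the open square (where `A` lives). -/
theorem klfp_integrand_cut_eq (hAsupp : ∀ p : ℝ × ℝ, A p ≠ 0 → |p.1| < π ∧ |p.2| < π) {n : ℕ}
    (hin : ∀ s, s ≤ (klScale klE0 n / 2) ^ 2 → f s = 0)
    (he'δ : ∀ p : ℝ × ℝ, |p.1| < π → |p.2| < π → |e' p - klfb_band δ μ p| ≤ δmax) (hδmax : δmax ≤ klScale klE0 n / 8)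
    {k₀ q₀ : ℝ} (hq₀ : |q₀| ≤ klScale klE0 n / 8) (p : ℝ × ℝ) :
    klfb_integrand δ μ A f f' e' k₀ q₀ p =
      klfb_integrand δ μ A f (fun s => f' s * (klfp_cut (klScale klE0 n) s : ℂ)) e' k₀ q₀ p := by
  have hΛ := klth_klScale_pos n
  unfold klfb_integrand
  by_cases hA : A p = 0
  · simp only [hA, zero_mul]
  by_cases hs : k₀ ^ 2 + klfb_band δ μ p ^ 2 ≤ (klScale klE0 n / 2) ^ 2
  · simp only [klfb_prop, hin _ hs, zero_div, zero_mul, mul_zero]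
  · -- the second line is read at `s' ≥ (Λ/8)²`
    obtain ⟨h1, h2⟩ := hAsupp p hA
    have hσ : |e' p - klfb_band δ μ p| ≤ klScale klE0 n / 8 := (he'δ p h1 h2).trans hδmax
    have hs' := klfp_sq_ge hΛ.le (not_le.mp hs) hq₀ hσ
    rw [add_sub_cancel] at hs'
    simp only [klfb_prop, klfp_cutWeight_eq hΛ.ne' hs']

/-- The zero-transfer product is unchanged by the cut: `f(s)·f''(s) = f(s)·f'(s)` (the first weight vanishes for `s ≤ (Λ_n/2)² ≥ (Λ_n/8)²`). -/
theorem klfp_mul_cutWeight_eq {n : ℕ} (hin : ∀ s, s ≤ (klScale klE0 n / 2) ^ 2 → f s = 0) (s : ℝ) :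
    f s * (f' s * (klfp_cut (klScale klE0 n) s : ℂ)) = f s * f' s := by
  have hΛ := klth_klScale_pos n
  by_cases hs : s ≤ (klScale klE0 n / 2) ^ 2
  · rw [hin s hs, zero_mul, zero_mul]
  · rw [klfp_cutWeight_eq hΛ.ne' (by nlinarith [not_le.mp hs])]

end CutIntegrand

/-! ## §4 The soft-partner planar bound (second weight without inner support radius) -/

section Soft

variable {a b : ℝ} (B : BandBounds a b) {δ : (Fin 2 → ℝ) → ℝ} (hδ1 : ContDiff ℝ 1 δ) {κ₀ κ₁ : ℝ}
  (hδ : ∀ k : Fin 2 → ℝ, (∀ i, |k i| ≤ π) → |δ k| ≤ κ₀)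
  (hκ : ∀ k : Fin 2 → ℝ, (∀ i, |k i| ≤ π) → ‖fderiv ℝ δ k‖ ≤ κ₁) (hκ₁ : κ₁ < B.Dtmin)

include B hδ1 hδ hκ hκ₁ in
/-- **THE FORWARD SLICE BUBBLE WITH A SOFT PARTNER, planar.**  As `klfb_planar_bubble_norm_le` EXCEPT: the second weight `f'` is only Lipschitz
(`≤ ℓ'/Λ_n²`), bounded (`M_f'`) and zero for `s ≥ (4Λ_n)²` — NO inner support radius (e.g. the soft covariance's `d_n = 1 − χ₂(s/Λ_n²)`) — and the
transfer is below resolution: `|q₀| ≤ Λ_n/8`, `δ_max ≤ Λ_n/8`.  Then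
`‖β⁻¹•Σ_i ∫d²p A(p)Φ_f(ω_i,e(p))Φ_{f'}(ω_i+q₀,e'(p))‖ ≤ 2π·[(524288/π)(ℓ+8M_F)L_WΛ_n + (393216/π)(ℓ+8M_F)B_W(π/β)/Λ_n + (256/π)M_f B_W((65ℓ'+17408M_f'/3)/Λ_n)(|q₀|+δ_max)]`. -/
theorem klfp_planar_bubble_norm_le_soft {A : ℝ × ℝ → ℂ} (hA : Continuous A)
    (hAsupp : ∀ p : ℝ × ℝ, A p ≠ 0 → |p.1| < π ∧ |p.2| < π) {A₀ A₁ : ℝ} (hA0 : ∀ p, ‖A p‖ ≤ A₀)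
    (hA1 : ∀ θ t t' : ℝ, 0 ≤ t → 0 ≤ t' →
      ‖A (t * Real.cos θ, t * Real.sin θ) - A (t' * Real.cos θ, t' * Real.sin θ)‖ ≤ A₁ * |t - t'|)
    {κ₂ : ℝ} (hκ₂ : 0 ≤ κ₂)
    (hD2 : ∀ θ s t : ℝ, s ∈ Icc 0 (π / ‖dir θ‖) → t ∈ Icc 0 (π / ‖dir θ‖) →
      |fderiv ℝ δ (s • dir θ) (dir θ) - fderiv ℝ δ (t • dir θ) (dir θ)| ≤ κ₂ * |s - t|)
    {f f' : ℝ → ℂ} {Lf Mf Lf' Mf' ℓ' LF MF ℓ : ℝ} {n : ℕ}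
    (hlip : ∀ s s', ‖f s - f s'‖ ≤ Lf * |s - s'|) (hbd : ∀ s, ‖f s‖ ≤ Mf)
    (hin : ∀ s, s ≤ (klScale klE0 n / 2) ^ 2 → f s = 0) (hout : ∀ s, (4 * klScale klE0 n) ^ 2 ≤ s → f s = 0)
    (hlip' : ∀ s s', ‖f' s - f' s'‖ ≤ Lf' * |s - s'|) (hbd' : ∀ s, ‖f' s‖ ≤ Mf') (hLf' : Lf' ≤ ℓ' / klScale klE0 n ^ 2)
    (hout' : ∀ s, (4 * klScale klE0 n) ^ 2 ≤ s → f' s = 0)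
    (hMF : 0 ≤ MF) (hFlip : ∀ s s', ‖f s * f' s - f s' * f' s'‖ ≤ LF * |s - s'|) (hFbd : ∀ s, ‖f s * f' s‖ ≤ MF)
    (hLF : LF ≤ ℓ / klScale klE0 n ^ 2)
    {e' : ℝ × ℝ → ℝ} (he' : Continuous e') {μ δmax : ℝ} (hδ0 : 0 ≤ δmax) (hδmax : δmax ≤ klScale klE0 n / 8)
    (he'δ : ∀ p : ℝ × ℝ, |p.1| < π → |p.2| < π → |e' p - klfb_band δ μ p| ≤ δmax)
    (hlo : a < μ - 4 * klScale klE0 n - κ₀) (hhi : μ + 4 * klScale klE0 n + κ₀ < b)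
    {q₀ : ℝ} (hq₀ : |q₀| ≤ klScale klE0 n / 8) {β : ℝ} (hβ : klBetaMin ≤ β) (hn : n ≤ nScales β + 1) {M : ℕ}
    (hM : β * (4 * klScale klE0 n) / (2 * Real.pi) + 1 ≤ M) :
    ‖β⁻¹ • ∑ i : MatsubaraIdx M, ∫ p : ℝ × ℝ, klfb_integrand δ μ A f f' e' (matsubaraFreq β M i) q₀ p‖ ≤
      2 * Real.pi *
        (524288 / Real.pi * (ℓ + 8 * MF) *
            (Real.pi * Real.sqrt 2 / (B.Dtmin - κ₁) * A₁ / (B.Dtmin - κ₁) +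
              A₀ * (1 / (B.Dtmin - κ₁) ^ 2 + Real.pi * Real.sqrt 2 * (2 + κ₂) / (B.Dtmin - κ₁) ^ 3)) * klScale klE0 n +
          393216 / Real.pi * (ℓ + 8 * MF) * (A₀ * (Real.pi * Real.sqrt 2 / (B.Dtmin - κ₁))) * ((Real.pi / β) / klScale klE0 n) +
            256 / Real.pi * Mf * (A₀ * (Real.pi * Real.sqrt 2 / (B.Dtmin - κ₁))) *
              ((65 * ℓ' + 17408 / 3 * Mf') / klScale klE0 n ^ 2 * klScale klE0 n) * (|q₀| + δmax)) := by
  have hΛ := klth_klScale_pos n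
  have hMf' : 0 ≤ Mf' := (norm_nonneg _).trans (hbd' 0)
  have hLf'0 : 0 ≤ Lf' := by
    have := hlip' 0 1; norm_num at this; linarith [norm_nonneg (f' 0 - f' 1)]
  have hℓ' : 0 ≤ ℓ' := by
    have : 0 ≤ ℓ' / klScale klE0 n ^ 2 := hLf'0.trans hLf'
    rwa [le_div_iff₀ (by positivity), zero_mul] at this
  -- replace `f'` by the cut weight
  have hcut : ∀ i : MatsubaraIdx M, (∫ p : ℝ × ℝ, klfb_integrand δ μ A f f' e' (matsubaraFreq β M i) q₀ p) =
      ∫ p : ℝ × ℝ, klfb_integrand δ μ A f (fun s => f' s * (klfp_cut (klScale klE0 n) s : ℂ)) e' (matsubaraFreq β M i) q₀ p :=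
    fun i => integral_congr_ae (Filter.Eventually.of_forall fun p => klfp_integrand_cut_eq hAsupp hin he'δ hδmax hq₀ p)
  rw [Finset.sum_congr rfl fun i _ => hcut i]
  have hK' : 0 ≤ (65 * ℓ' + 17408 / 3 * Mf') / klScale klE0 n ^ 2 := by positivity
  have hFlip'' : ∀ s s', ‖f s * (f' s * (klfp_cut (klScale klE0 n) s : ℂ)) - f s' * (f' s' * (klfp_cut (klScale klE0 n) s' : ℂ))‖ ≤
      LF * |s - s'| := fun s s' => by rw [klfp_mul_cutWeight_eq hin s, klfp_mul_cutWeight_eq hin s']; exact hFlip s s'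
  have hFbd'' : ∀ s, ‖f s * (f' s * (klfp_cut (klScale klE0 n) s : ℂ))‖ ≤ MF := fun s => by
    rw [klfp_mul_cutWeight_eq hin s]; exact hFbd s
  exact klfs_planar_bubble_norm_le_of_lipschitz B hδ1 hδ hκ hκ₁ hA hAsupp hA0 hA1 hκ₂ hD2 hlip hbd hin hout hK'
    (klfp_prop_cutWeight_lipschitz hlip' hbd' hLf' hout') hMF hFlip'' hFbd'' hLF he' hδ0 he'δ hlo hhi q₀ hβ hn hM

end Soft

/-! ## §5 The carrier instance `(w_n, d_n)`: slice line × soft partner, absolute constants -/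

section Carrier

variable {a b : ℝ} (B : BandBounds a b) {δ : (Fin 2 → ℝ) → ℝ} (hδ1 : ContDiff ℝ 1 δ) {κ₀ κ₁ : ℝ}
  (hδ : ∀ k : Fin 2 → ℝ, (∀ i, |k i| ≤ π) → |δ k| ≤ κ₀)
  (hκ : ∀ k : Fin 2 → ℝ, (∀ i, |k i| ≤ π) → ‖fderiv ℝ δ k‖ ≤ κ₁) (hκ₁ : κ₁ < B.Dtmin)

/-- **The soft weight `d_n(s) = 1 − χ₂(s/Λ_n²)`** of `C^K_{≤Λ_n}`: `‖d_n‖ ≤ 1`, `(32/3)/Λ_n²`-Lipschitz, `d_n = 0` for `s ≥ (4Λ_n)²` (indeed for `s ≥ Λ_n²`). -/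
theorem klfp_softWeight_hypotheses (n : ℕ) :
    (∀ s, ‖((1 - salmhoferCutoff (s / klScale klE0 n ^ 2) : ℝ) : ℂ)‖ ≤ 1) ∧
    (∀ s s', ‖((1 - salmhoferCutoff (s / klScale klE0 n ^ 2) : ℝ) : ℂ) - ((1 - salmhoferCutoff (s' / klScale klE0 n ^ 2) : ℝ) : ℂ)‖ ≤
      (32 / 3) / klScale klE0 n ^ 2 * |s - s'|) ∧
    (∀ s, (4 * klScale klE0 n) ^ 2 ≤ s → ((1 - salmhoferCutoff (s / klScale klE0 n ^ 2) : ℝ) : ℂ) = 0) := by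
  have hΛ := klth_klScale_pos n
  have hΛ2 : 0 < klScale klE0 n ^ 2 := by positivity
  refine ⟨fun s => ?_, fun s s' => ?_, fun s hs => ?_⟩
  · have hm := salmhoferCutoff_mem_Icc (s / klScale klE0 n ^ 2)
    rw [Complex.norm_real, Real.norm_eq_abs, abs_le]
    exact ⟨by linarith [hm.2], by linarith [hm.1]⟩
  · rw [← Complex.ofReal_sub, Complex.norm_real, Real.norm_eq_abs]
    have h := klcd_lipschitz_salmhoferCutoff_sharp (s' / klScale klE0 n ^ 2) (s / klScale klE0 n ^ 2)
    have heq : |s' / klScale klE0 n ^ 2 - s / klScale klE0 n ^ 2| = |s - s'| / klScale klE0 n ^ 2 := by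
      rw [← sub_div, abs_div, abs_of_pos hΛ2, abs_sub_comm]
    rw [heq] at h
    calc |1 - salmhoferCutoff (s / klScale klE0 n ^ 2) - (1 - salmhoferCutoff (s' / klScale klE0 n ^ 2))|
        = |salmhoferCutoff (s' / klScale klE0 n ^ 2) - salmhoferCutoff (s / klScale klE0 n ^ 2)| := by ring_nf
      _ ≤ 32 / 3 * (|s - s'| / klScale klE0 n ^ 2) := h
      _ = (32 / 3) / klScale klE0 n ^ 2 * |s - s'| := by ring
  · have h1 : 1 ≤ s / klScale klE0 n ^ 2 := by
      rw [le_div_iff₀ hΛ2]; nlinarith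
    rw [salmhoferCutoff_of_ge h1, sub_self, Complex.ofReal_zero]

include B hδ1 hδ hκ hκ₁ in
/-- **THE FORWARD SLICE BUBBLE, SLICE LINE × SOFT PARTNER, with the CARRIER's weights** `w_n(s) = χ₂(s/Λ_n²) − χ₂(s/Λ_{n−1}²)` (first line) and
`d_n(s) = 1 − χ₂(s/Λ_n²)` (second line; the rung term `g_n⊗D_n` of the Wick-ordered step), `n ≥ 1`, below-resolution transfer
(`|q₀| ≤ Λ_n/8`, `δ_max ≤ Λ_n/8`): with `d = Dt_min − κ₁`, `B_W = A₀π√2/d`, `L_W = (π√2/d)A₁/d + A₀(1/d² + π√2(2+κ₂)/d³)`,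
`‖β⁻¹•Σ_i ∫d²p A(p)Φ_{w_n}(ω_i,e(p))Φ_{d_n}(ω_i+q₀,e'(p))‖ ≤ 2^25·L_W·Λ_n + 2^25·B_W·(π/β)/Λ_n + 2^22·B_W·(|q₀| + δ_max)/Λ_n`. -/
theorem klfp_planar_softBubble_norm_le {A : ℝ × ℝ → ℂ} (hA : Continuous A)
    (hAsupp : ∀ p : ℝ × ℝ, A p ≠ 0 → |p.1| < π ∧ |p.2| < π) {A₀ A₁ : ℝ} (hA0 : ∀ p, ‖A p‖ ≤ A₀)
    (hA1 : ∀ θ t t' : ℝ, 0 ≤ t → 0 ≤ t' →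
      ‖A (t * Real.cos θ, t * Real.sin θ) - A (t' * Real.cos θ, t' * Real.sin θ)‖ ≤ A₁ * |t - t'|)
    {κ₂ : ℝ} (hκ₂ : 0 ≤ κ₂)
    (hD2 : ∀ θ s t : ℝ, s ∈ Icc 0 (π / ‖dir θ‖) → t ∈ Icc 0 (π / ‖dir θ‖) →
      |fderiv ℝ δ (s • dir θ) (dir θ) - fderiv ℝ δ (t • dir θ) (dir θ)| ≤ κ₂ * |s - t|)
    {n : ℕ} (hn1 : 1 ≤ n) {e' : ℝ × ℝ → ℝ} (he' : Continuous e') {μ δmax : ℝ} (hδ0 : 0 ≤ δmax)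
    (hδmax : δmax ≤ klScale klE0 n / 8)
    (he'δ : ∀ p : ℝ × ℝ, |p.1| < π → |p.2| < π → |e' p - klfb_band δ μ p| ≤ δmax)
    (hlo : a < μ - 4 * klScale klE0 n - κ₀) (hhi : μ + 4 * klScale klE0 n + κ₀ < b)
    {q₀ : ℝ} (hq₀ : |q₀| ≤ klScale klE0 n / 8) {β : ℝ} (hβ : klBetaMin ≤ β) (hn : n ≤ nScales β + 1) {M : ℕ}
    (hM : β * (4 * klScale klE0 n) / (2 * Real.pi) + 1 ≤ M) :
    ‖β⁻¹ • ∑ i : MatsubaraIdx M, ∫ p : ℝ × ℝ,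
        klfb_integrand δ μ A
          (fun s => ((salmhoferCutoff (s / klScale klE0 n ^ 2) - salmhoferCutoff (s / klScale klE0 (n - 1) ^ 2) : ℝ) : ℂ))
          (fun s => ((1 - salmhoferCutoff (s / klScale klE0 n ^ 2) : ℝ) : ℂ))
          e' (matsubaraFreq β M i) q₀ p‖ ≤
      2 ^ 25 * (Real.pi * Real.sqrt 2 / (B.Dtmin - κ₁) * A₁ / (B.Dtmin - κ₁) +
            A₀ * (1 / (B.Dtmin - κ₁) ^ 2 + Real.pi * Real.sqrt 2 * (2 + κ₂) / (B.Dtmin - κ₁) ^ 3)) * klScale klE0 n +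
        2 ^ 25 * (A₀ * (Real.pi * Real.sqrt 2 / (B.Dtmin - κ₁))) * ((Real.pi / β) / klScale klE0 n) +
          2 ^ 22 * (A₀ * (Real.pi * Real.sqrt 2 / (B.Dtmin - κ₁))) * (|q₀| + δmax) / klScale klE0 n := by
  obtain ⟨hb, hl, hi, ho⟩ := klwt_sliceWeight_hypotheses_sharp hn1
  obtain ⟨hb', hl', ho'⟩ := klfp_softWeight_hypotheses n
  have hΛ := klth_klScale_pos n
  have hd : 0 < B.Dtmin - κ₁ := by linarith
  have hA0' : 0 ≤ A₀ := (norm_nonneg _).trans (hA0 0)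
  have hA1' : 0 ≤ A₁ := klfb_radialLip_nonneg hA1
  have hFbd : ∀ s, ‖((salmhoferCutoff (s / klScale klE0 n ^ 2) - salmhoferCutoff (s / klScale klE0 (n - 1) ^ 2) : ℝ) : ℂ) *
      ((1 - salmhoferCutoff (s / klScale klE0 n ^ 2) : ℝ) : ℂ)‖ ≤ 1 := fun s => (klwt_mul_norm_le hb hb' s).trans (by norm_num)
  have hFlip : ∀ s s', ‖((salmhoferCutoff (s / klScale klE0 n ^ 2) - salmhoferCutoff (s / klScale klE0 (n - 1) ^ 2) : ℝ) : ℂ) *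
        ((1 - salmhoferCutoff (s / klScale klE0 n ^ 2) : ℝ) : ℂ) -
      ((salmhoferCutoff (s' / klScale klE0 n ^ 2) - salmhoferCutoff (s' / klScale klE0 (n - 1) ^ 2) : ℝ) : ℂ) *
        ((1 - salmhoferCutoff (s' / klScale klE0 n ^ 2) : ℝ) : ℂ)‖ ≤ 22 / klScale klE0 n ^ 2 * |s - s'| := fun s s' =>
    (klwt_mul_lipschitz hb hb' hl hl' s s').trans (le_of_eq (by ring))
  have h := klfp_planar_bubble_norm_le_soft B hδ1 hδ hκ hκ₁ hA hAsupp hA0 hA1 hκ₂ hD2 hl hb hi ho hl' hb' le_rfl ho' zero_le_one hFlip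
    hFbd le_rfl he' hδ0 hδmax he'δ hlo hhi hq₀ hβ hn hM
  refine h.trans ?_
  set LW := Real.pi * Real.sqrt 2 / (B.Dtmin - κ₁) * A₁ / (B.Dtmin - κ₁) +
    A₀ * (1 / (B.Dtmin - κ₁) ^ 2 + Real.pi * Real.sqrt 2 * (2 + κ₂) / (B.Dtmin - κ₁) ^ 3) with hLW_def
  set BW := A₀ * (Real.pi * Real.sqrt 2 / (B.Dtmin - κ₁)) with hBW_def
  have hLW : 0 ≤ LW := by rw [hLW_def]; positivity
  have hBW : 0 ≤ BW := by rw [hBW_def]; positivity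
  have hπ := Real.pi_pos
  have hq : 0 ≤ |q₀| + δmax := by positivity
  have hβ0 : 0 < β := pos_of_klBetaMin_le hβ
  have e1 : 2 * Real.pi * (524288 / Real.pi * (22 + 8 * 1) * LW * klScale klE0 n) = (2 * 524288 * 30) * (LW * klScale klE0 n) := by
    field_simp; ring
  have e2 : 2 * Real.pi * (393216 / Real.pi * (22 + 8 * 1) * BW * ((Real.pi / β) / klScale klE0 n)) =
      (2 * 393216 * 30) * (BW * ((Real.pi / β) / klScale klE0 n)) := by
    field_simp; ring
  have e3 : 2 * Real.pi * (256 / Real.pi * 1 * BW * ((65 * (32 / 3) + 17408 / 3 * 1) / klScale klE0 n ^ 2 * klScale klE0 n) * (|q₀| + δmax)) =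
      (2 * 256 * (65 * (32 / 3) + 17408 / 3)) * (BW * (|q₀| + δmax) / klScale klE0 n) := by
    field_simp
  have t1 : 0 ≤ LW * klScale klE0 n := by positivity
  have t2 : 0 ≤ BW * ((Real.pi / β) / klScale klE0 n) := by positivity
  have t3 : 0 ≤ BW * (|q₀| + δmax) / klScale klE0 n := by positivity
  rw [mul_add, mul_add, e1, e2, e3]
  have c1 : (2 : ℝ) * 524288 * 30 ≤ 2 ^ 25 := by norm_num
  have c2 : (2 : ℝ) * 393216 * 30 ≤ 2 ^ 25 := by norm_num
  have c3 : (2 : ℝ) * 256 * (65 * (32 / 3) + 17408 / 3) ≤ 2 ^ 22 := by norm_num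
  have f1 : (2 : ℝ) ^ 25 * LW * klScale klE0 n = 2 ^ 25 * (LW * klScale klE0 n) := by ring
  have f2 : (2 : ℝ) ^ 25 * BW * ((Real.pi / β) / klScale klE0 n) = 2 ^ 25 * (BW * ((Real.pi / β) / klScale klE0 n)) := by ring
  have f3 : (2 : ℝ) ^ 22 * BW * (|q₀| + δmax) / klScale klE0 n = 2 ^ 22 * (BW * (|q₀| + δmax) / klScale klE0 n) := by ring
  rw [f1, f2, f3]
  exact add_le_add (add_le_add (mul_le_mul_of_nonneg_right c1 t1) (mul_le_mul_of_nonneg_right c2 t2)) (mul_le_mul_of_nonneg_right c3 t3)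

end Carrier

end Summit.HubbardSuperconductivity.HubbardSuperconductivity.Theorems.KLRegimeSplit

end
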